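import Summits.BirchSwinnertonDyer.Rank1Residual.ManinAdditive.ShimuraIndexFrickeLaw
import Literature.NumberTheory.EllipticCurves.PAdicLFunctionDistributionProofs
import Literature.NumberTheory.EllipticCurves.CongruenceNumber
import HarnessLib

/-!
# THEOREM Φ′ (E-es-70 `ShimuraIndexPrimeToOfPlusIndex`): complex conjugation acts trivially on `Λ₀(f)/Λ₁(f)`

Summit `BirchSwinnertonDyer`, sub-problem `BirchSwinnertonDyer`, route `ManinLocalTwoThree`; width seat `bsd-line-manin23-p2`
(gen 9), `--supports` the crux C3 `ManinPrimeToThreeAtNine` (stmt-BirchSwinnertonDyer-22968).  Cell `bsd-f2-manin`, es lens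
(es g20 MEMO-es §33.2, leaf `…ManinAdditive.ShimuraIndexFrickeLaw`, namespace `…ManinAdditive.KatoCurve`): the Shimura index
`[Λ₀(f) : Λ₁(f)]` (`Λ₀ = periodLattice f` over `Γ₀(N)`, `Λ₁ = periodLatticeGamma1 f` over `Γ₁(N)`) versus the plus index.
The row E-es-70 («typed as a law, paper proof MEMO-es §33.2») is a THEOREM, by the following mechanism.

KEY LEMMA (`conj_sub_self_mem_periodLatticeGamma1`): for `f` with REAL Fourier coefficients and every `x ∈ Λ₀(f)`,
`x̄ − x ∈ Λ₁(f)` — complex conjugation acts TRIVIALLY on `Λ₀/Λ₁`.  Indeed on generators `x = {∞, γ∞}`,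
`x̄ = {∞, γ′∞}` with `γ′ = JγJ = (a, −b; −c, d)` (`modularSymbol_neg_eq_conj`), which has the SAME lower-right entry `d`,
and periods of `Γ₀(N)`-elements with equal `d mod N` differ by a `Γ₁(N)`-period
(`cuspSymbol_sub_mem_periodLatticeGamma1_of_apply_eq`).

THEOREM Φ′ (`shimuraIndexPrimeTo_of_plusIndexPrimeTo`): for real `f` and an odd prime `p`, `PlusIndexPrimeTo p f ⟹
ShimuraIndexPrimeTo p f`.  Proof: let `x ∈ Λ₀` with `p x ∈ Λ₁`; the plus hypothesis gives `k (x + x̄) = y + ȳ` with `y ∈ Λ₁`,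
`p ∤ k`; by the key lemma `x + x̄ ≡ 2x` and `y + ȳ ≡ 2y ≡ 0 (mod Λ₁)`, so `2k·x ∈ Λ₁`; with `p·x ∈ Λ₁` and
`gcd(2k, p) = 1` (Bézout) `x ∈ Λ₁`.

PROVED here (sorry-free): `exists_cuspSymbol_eq_conj_and_apply_eq`, **`conj_sub_self_mem_periodLatticeGamma1`**,
`two_mul_mem_periodLatticeGamma1_of_plus`, **`shimuraIndexPrimeTo_of_plusIndexPrimeTo`**,
**`shimuraIndexPrimeToOfPlusIndex_holds : ShimuraIndexPrimeToOfPlusIndex`** (E-es-70 BY NAME), and the resulting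
equivalence `plusIndexPrimeTo_iff_shimuraIndexPrimeTo'` (with the leaf's proved converse).

Elementary.  BSD is not proved by this; Manin's conjecture is not proved by this; C3 is not closed by this.
-/

set_option autoImplicit false
set_option linter.dupNamespace false

noncomputable section

open scoped MatrixGroups ModularForm ComplexConjugate
open CongruenceSubgroup WeierstrassCurve
open Literature.NumberTheory.EllipticCurves Literature.NumberTheory.EllipticCurves.ModularForms
open Summit.BirchSwinnertonDyer.Rank1Residual.ManinAdditive
open Summit.BirchSwinnertonDyer.Rank1Residual.ManinAdditive.KatoCurve

namespace Summit.BirchSwinnertonDyer.BirchSwinnertonDyer.Theorems.ManinLocalTwoThree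

variable {N : ℕ} [NeZero N] {f : CuspForm (Gamma0 N) 2}

/-- For `f` with real coefficients: `conj {∞, γ∞}_f = {∞, γ′∞}_f` with `γ′ = (a, −b; −c, d) ∈ Γ₀(N)` — a matrix with the
SAME lower-right entry (refinement of the tree's `exists_cuspSymbol_eq_conj`, Cremona §2.6 / Manin 1972 §1.6). -/
theorem exists_cuspSymbol_eq_conj_and_apply_eq (h : ∀ n, (cuspCoeff f n).im = 0) (γ : Gamma0 N) :
    ∃ γ' : Gamma0 N, (γ' : SL(2, ℤ)) 1 1 = (γ : SL(2, ℤ)) 1 1 ∧ cuspSymbol f γ' = conj (cuspSymbol f γ) := by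
  have hdet :
      (γ : SL(2, ℤ)) 0 0 * (γ : SL(2, ℤ)) 1 1 - (γ : SL(2, ℤ)) 0 1 * (γ : SL(2, ℤ)) 1 0 = 1 := by
    have := Matrix.det_fin_two (γ : SL(2, ℤ)).1
    rw [(γ : SL(2, ℤ)).2] at this
    linear_combination -this
  let M : SL(2, ℤ) := ⟨!![(γ : SL(2, ℤ)) 0 0, -((γ : SL(2, ℤ)) 0 1);
      -((γ : SL(2, ℤ)) 1 0), (γ : SL(2, ℤ)) 1 1], by
    rw [Matrix.det_fin_two_of]; linear_combination hdet⟩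
  have hM : M ∈ Gamma0 N := by
    rw [Gamma0_mem]
    have hγ := Gamma0_mem.mp γ.2
    simp only [M, Matrix.of_apply, Matrix.cons_val', Matrix.cons_val_zero, Matrix.cons_val_one,
      Int.cast_neg, hγ, neg_zero]
  refine ⟨⟨M, hM⟩, rfl, ?_⟩
  have h00 : ((⟨M, hM⟩ : Gamma0 N) : SL(2, ℤ)) 0 0 = (γ : SL(2, ℤ)) 0 0 := rfl
  have h10 : ((⟨M, hM⟩ : Gamma0 N) : SL(2, ℤ)) 1 0 = -((γ : SL(2, ℤ)) 1 0) := rfl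
  unfold cuspSymbol
  rw [h00, h10]
  by_cases hc : (γ : SL(2, ℤ)) 1 0 = 0
  · rw [if_pos hc, if_pos (neg_eq_zero.mpr hc), map_zero]
  · rw [if_neg hc, if_neg (neg_eq_zero.not.mpr hc), ← modularSymbol_neg_eq_conj_holds f h,
      Int.cast_neg, div_neg]

/-- **KEY LEMMA: complex conjugation acts trivially on `Λ₀(f)/Λ₁(f)`** — for `f` with real Fourier coefficients and every
`x ∈ Λ₀(f)`, `x̄ − x ∈ Λ₁(f)`. -/
theorem conj_sub_self_mem_periodLatticeGamma1 (h : ∀ n, (cuspCoeff f n).im = 0) {x : ℂ} (hx : x ∈ periodLattice f) :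
    conj x - x ∈ periodLatticeGamma1 f := by
  induction hx using AddSubgroup.closure_induction with
  | mem z hz =>
    obtain ⟨γ, rfl⟩ := hz
    obtain ⟨γ', hd, hγ'⟩ := exists_cuspSymbol_eq_conj_and_apply_eq h γ
    rw [← hγ']
    exact cuspSymbol_sub_mem_periodLatticeGamma1_of_apply_eq f γ γ' (by rw [hd])
  | zero => simp
  | add a b _ _ ha hb =>
    have e : conj (a + b) - (a + b) = (conj a - a) + (conj b - b) := by rw [map_add]; ring
    rw [e]
    exact (periodLatticeGamma1 f).add_mem ha hb
  | neg a _ ha =>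
    have e : conj (-a) - -a = -(conj a - a) := by rw [map_neg]; ring
    rw [e]
    exact (periodLatticeGamma1 f).neg_mem ha

/-- From the plus hypothesis: `2k·x ∈ Λ₁(f)` for some `k` prime to `p` (real `f`, `x ∈ Λ₀(f)`). -/
theorem two_mul_mem_periodLatticeGamma1_of_plus (h : ∀ n, (cuspCoeff f n).im = 0) {p : ℕ} (hplus : PlusIndexPrimeTo p f)
    {x : ℂ} (hx : x ∈ periodLattice f) : ∃ k : ℕ, ¬ p ∣ k ∧ (2 * k : ℂ) * x ∈ periodLatticeGamma1 f := by
  obtain ⟨y, hy, k, hk, hkeq⟩ := hplus x hx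
  refine ⟨k, hk, ?_⟩
  have hx1 := conj_sub_self_mem_periodLatticeGamma1 h hx
  have hy1 := conj_sub_self_mem_periodLatticeGamma1 h (periodLatticeGamma1_le_periodLattice f hy)
  -- `2k x = k (x + x̄) − k (x̄ − x) = (y + ȳ) − k (x̄ − x) = 2y + (ȳ − y) − k(x̄ − x)`
  have e : (2 * k : ℂ) * x = 2 * y + (conj y - y) - (k : ℂ) * (conj x - x) := by
    linear_combination hkeq
  rw [e]
  refine (periodLatticeGamma1 f).sub_mem ((periodLatticeGamma1 f).add_mem ?_ hy1) ?_
  · simpa [two_mul] using (periodLatticeGamma1 f).add_mem hy hy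
  · have : (k : ℂ) * (conj x - x) = (k : ℤ) • (conj x - x) := by simp [zsmul_eq_mul]
    rw [this]
    exact (periodLatticeGamma1 f).zsmul_mem hx1 k

/-- **THEOREM Φ′** (es g20 MEMO-es §33.2): for `f` with real Fourier coefficients and an odd prime `p`, plus index prime to `p`
implies Shimura index prime to `p`. -/
theorem shimuraIndexPrimeTo_of_plusIndexPrimeTo (h : ∀ n, (cuspCoeff f n).im = 0) {p : ℕ} (hp : p.Prime) (hp2 : p ≠ 2)
    (hplus : PlusIndexPrimeTo p f) : ShimuraIndexPrimeTo p f := by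
  intro x hx hpx
  obtain ⟨k, hk, h2k⟩ := two_mul_mem_periodLatticeGamma1_of_plus h hplus hx
  -- Bézout: `gcd(2k, p) = 1`
  have hcop : Nat.Coprime (2 * k) p := by
    refine Nat.Coprime.mul_left ?_ ?_
    · exact (Nat.coprime_primes Nat.prime_two hp).mpr (Ne.symm hp2)
    · exact ((Nat.Prime.coprime_iff_not_dvd hp).mpr hk).symm
  obtain ⟨a, b, hab⟩ : ∃ a b : ℤ, a * ((2 * k : ℕ) : ℤ) + b * (p : ℤ) = 1 := Nat.isCoprime_iff_coprime.mpr hcop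
  have habC : (a : ℂ) * (2 * k : ℂ) + (b : ℂ) * (p : ℂ) = 1 := by exact_mod_cast hab
  have e : x = a • ((2 * k : ℂ) * x) + b • ((p : ℂ) * x) := by
    simp only [zsmul_eq_mul]
    linear_combination -(habC) * x
  rw [e]
  exact (periodLatticeGamma1 f).add_mem ((periodLatticeGamma1 f).zsmul_mem h2k a)
    ((periodLatticeGamma1 f).zsmul_mem hpx b)

/-- **E-es-70 `ShimuraIndexPrimeToOfPlusIndex` IS A THEOREM** (es g20 THEOREM Φ′, leaf `ShimuraIndexFrickeLaw`): for the newform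
of an elliptic curve (integer, hence real, coefficients) and an odd prime `p`, plus index prime to `p` implies Shimura index
prime to `p`.  BSD is not proved by this. -/
theorem shimuraIndexPrimeToOfPlusIndex_holds : ShimuraIndexPrimeToOfPlusIndex := by
  intro W _ _ N _ D p hp hp2 hplus
  have hreal : ∀ n, (cuspCoeff D.f n).im = 0 := fun n => by
    rw [D.isNewformOf.2 n]; exact Complex.intCast_im _
  exact shimuraIndexPrimeTo_of_plusIndexPrimeTo hreal hp hp2 hplus

/-- The equivalence «plus index prime to `p` ⟺ Shimura index prime to `p`» for curve newforms and odd `p`, now unconditional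
(the leaf's `plusIndexPrimeTo_iff_shimuraIndexPrimeTo` fed with `shimuraIndexPrimeToOfPlusIndex_holds`). -/
theorem plusIndexPrimeTo_iff_shimuraIndexPrimeTo' (W : WeierstrassCurve ℚ) [W.IsElliptic] [W.IsGloballyMinimal]
    {N : ℕ} [NeZero N] (D : ModularParametrizationData W N) {p : ℕ} (hp : p.Prime) (hp2 : p ≠ 2) :
    PlusIndexPrimeTo p D.f ↔ ShimuraIndexPrimeTo p D.f :=
  plusIndexPrimeTo_iff_shimuraIndexPrimeTo shimuraIndexPrimeToOfPlusIndex_holds W D hp hp2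

end Summit.BirchSwinnertonDyer.BirchSwinnertonDyer.Theorems.ManinLocalTwoThree

end
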